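import Literature.Probability.Percolation.ShieldedPathsSecondMoment
import Literature.Probability.Percolation.DifferenceChainS2Visits
import HarnessLib

/-!
# `p_c(d) < p_shield(d)` from closed numerical inequalities (BDNS Corollary 1.5, the reduction)

Topic `Literature/Probability/Percolation`.  Sorry-free, no named facts.  This file assembles the
proof of Corollary 1.5 of Bock–Damron–Newman–Sidoravicius, *Percolation of finite clusters and
shielded paths*, J. Stat. Phys. 179 (2020), §4 pp. 10–11, up to the numerical table: "To give an
explicit lower bound on `p_shield(d)`, we will show that for `p = g(d)` the two conditions of
Theorem 1.2 hold … For any `d` such that these inequalities hold, we must have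
`p_shield(d) > p_c(d)`.  Indeed … they will also hold for some number `p̂ > g(d)` … and we will have
`p_c ≤ g(d) < p̂ ≤ p_shield(d)`."

**`criticalProb_lt_pShield_of_numerics`**: for `d ≥ 2`, given real numbers
`T, g, p̂, ρ, r, V_S, V_0` with

* `Σ_{j ≤ n} (jd)!/((j!)^d d^{jd}) ≤ T` for all `n` (the Stirling tail, `BalancedTermTail.lean`),
* `rhoHead d + rhoMid d + T ≤ g < p̂ < 1` (so `p_c(d) ≤ ρ_d ≤ g`, `criticalProb_zd_le_rho`),
* `retHead d + retMid d + d T ≤ ρ`, `1/d < ρ < 1` (so `p_d ≤ ρ`, `retProb_zero_le`) and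
  `t(ρ) - 1/d² = 1 - (1-ρ)/(d²ρ - d) - 1/d² ≤ r` (so the renewal parameter is `≤ r`,
  `hS_le_of_retProb_le`),
* and the renewal inequalities of Lemma 3.1 at `q̂ = 1 - p̂`, `α = q̂^{-(2d-1)}`, `β = q̂^{-1}`:
  `1 ≤ βV_S`, `1 ≤ αV_0`, `0 < V_0`, `1 + (1 - 1/d)(βV_S - 1) + (1/d)(αV_0 - 1) ≤ V_0`,
  `1 + r(βV_S - 1) + (1/d²)(αV_0 - 1) ≤ V_S` (solvable iff `dq̂^{2d-1} > 1` and `f(q̂) < q̂`, the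
  two conditions of Theorem 1.2),

one has `p_c(d) ≤ g < p̂ ≤ p_shield(d)`.

## References

* B. Bock, M. Damron, C. M. Newman, V. Sidoravicius, J. Stat. Phys. 179 (2020) 789–807,
  arXiv:1811.01678, §4 (proof of Cor 1.5), Thm 1.2, Lemma 3.1, Lemma 4.1. [BockEtAl2020]
-/

noncomputable section

namespace Literature.Probability.Percolation

open Finset Literature.Probability.LatticeModels

variable {d : ℕ}

/-- **BDNS Corollary 1.5, reduced to closed inequalities** (see the module docstring).
[cite: BockEtAl2020, §4 (proof of Cor 1.5)] -/
theorem criticalProb_lt_pShield_of_numerics (hd : 2 ≤ d) {T g p ρ r VS V0 : ℝ}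
    (hT : ∀ n, ∑ j ∈ Icc 1 n, balancedTerm d j ≤ T)
    (hg : rhoHead d + rhoMid d + T ≤ g) (hgp : g < p) (hp1 : p < 1)
    (hρ : retHead d + retMid d + d * T ≤ ρ) (hρd : 1 / (d : ℝ) < ρ) (hρ1 : ρ < 1)
    (hr : 1 - (1 - ρ) / ((d : ℝ) ^ 2 * ρ - d) - 1 / (d : ℝ) ^ 2 ≤ r)
    (hV0 : 0 < V0) (hβ : 1 ≤ (1 - p)⁻¹ * VS) (hα : 1 ≤ (1 - p)⁻¹ ^ (2 * d - 1) * V0)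
    (h0cond : 1 + (1 - 1 / d) * ((1 - p)⁻¹ * VS - 1) +
      (1 / d) * ((1 - p)⁻¹ ^ (2 * d - 1) * V0 - 1) ≤ V0)
    (hScond : 1 + r * ((1 - p)⁻¹ * VS - 1) +
      (1 / (d : ℝ) ^ 2) * ((1 - p)⁻¹ ^ (2 * d - 1) * V0 - 1) ≤ VS) :
    criticalProb (zdGraph d) 0 < pShield d := by
  have hd1 : 1 ≤ d := by omega
  have hd0 : (0 : ℝ) < d := by exact_mod_cast hd1
  -- `T ≥ 0`
  have hT0 : 0 ≤ T := (Finset.sum_nonneg fun j _ => balancedTerm_nonneg d j).trans (hT 1)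
  -- `p_c ≤ g`
  have hpc : criticalProb (zdGraph d) 0 ≤ g := (criticalProb_zd_le_rho hd1 hT0 hT).trans hg
  -- `0 ≤ p`
  have hp0 : 0 ≤ p := ((criticalProb_mem_Icc (zdGraph d) 0).1.trans hpc).trans hgp.le
  -- `p_d ≤ ρ`
  have hret : ∀ n, retProb d n (0 : Site d) ≤ ρ := by
    intro n
    have h1 := retProb_zero_le hd1 n
    have h2 := mul_le_mul_of_nonneg_left (hT (n + 1)) hd0.le
    linarith
  -- the renewal parameter
  have hr' : ∀ (n : ℕ) (z : Site d), IsS2 z → hS d n z ≤ r := fun n z hz =>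
    (hS_le_of_retProb_le hd hret hρd hρ1 n hz).trans hr
  -- `p ≤ p_shield`
  have hps : p ≤ pShield d :=
    le_pShield_of_renewal hd1 ⟨p, hp0, hp1.le⟩ hp1 hV0 hβ hα hr' h0cond hScond
  exact hpc.trans_lt (hgp.trans_le hps)

end Literature.Probability.Percolation

end
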